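import Mathlib
import Summits.ValiantsHypothesis.ValiantsHypothesis.Theorems.BarrierLeverPartitionMinorsHitByVPSimplexJoinAbsorb

/-!
# Route BarrierLever — item `PartitionMinorsHitByVP` (stmt-ValiantsHypothesis-19717):
# UNIFORM PIECES COMPOSE — iterated absorption for the simplex-product join door

Helper file (`--supports stmt-ValiantsHypothesis-19717`; cell valiant-natproofs, rung V4, 𝒟-side door (c), line
`hidden_states`; prover seat val-np-p3 gen 11). Definition-free. Closes NO item.

A piece of a design `e : Fin r → Fin m × (Fin D → Option (Fin N))` of the exact-support door (`…SimplexJoinDoor`) is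
UNIFORM when, for EVERY injective family `v` of as many subsets of `Fin h` as the piece has columns, some table makes the
piece's `u`-side block `[∏_{a ∈ v x} (t none a + Σ_f …)]` nonsingular ("the row matroid of the generic piece is the uniform
matroid"). **`good_of_uniform_pieces`**: if every piece of `e` is uniform then for EVERY injective `u : Fin r → Finset (Fin h)`
some table makes the whole `u`-side matrix nonsingular. Proof: strong induction on `r` by the ROW-THRESHOLD ABSORPTION
theorem `good_of_absorb` — sort the rows by the binary weight `Σ_{a ∈ u i} 2^a` (injective on an injective family,
`Finset.geomSum_injective`), give the `n` lightest rows to the piece of column `0` (good on them by uniformity) and the rest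
to the other pieces (good by induction). So a design all of whose pieces are uniform serves every pair `(u, w)` of
injective families of its size through `partitionMinor_hit_of_simplexJoin` (`partitionMinor_hit_of_uniformPieces`).

WHY IT MATTERS (seat memo §9, kit j304280/j304293/j304295/j304298/j304440): numerically many cheap pieces ARE uniform
(e.g. `4×4`, `5×3`, `B₂(5)`, `B₂(6)`, `B₂(7)` at `h = 5`; `5×5`, `6×3`, `6×6` at `h = 6`; `4×4×4`, `8×8`, `9×9`, `B₃(7)`, `B₃(8)` at
`h = 7`; `12×12`, `13×13` at `h = 9`), exactly the ones passing the seat's tensor-level count; uniform pieces of all sizes +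
this file reduce the item to single-piece uniformity statements plus arithmetic. WHAT THIS IS NOT: no piece is proved uniform
here (the simplex case is `…SimplexJoinUniformSimplex`); item 19717 stays OPEN; nothing on crux 14610 or VP ≠ VNP.
-/

set_option linter.dupNamespace false

namespace Summit.ValiantsHypothesis.ValiantsHypothesis.Theorems.BarrierLever.SimplexJoin

open Finset Matrix

/-- Binary weights separate the members of an injective family of finsets. -/
theorem binaryWeight_injective {h r : ℕ} (u : Fin r → Finset (Fin h)) (hu : Function.Injective u) :
    Function.Injective fun i => ∑ a ∈ u i, 2 ^ (a : ℕ) := by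
  intro i i' hii'
  apply hu
  have hmap : ∀ i, ∑ a ∈ u i, 2 ^ (a : ℕ) = ∑ t ∈ (u i).map Fin.valEmbedding, 2 ^ t := fun i => by
    rw [Finset.sum_map]; rfl
  simp only [hmap] at hii'
  exact Finset.map_injective Fin.valEmbedding (Finset.geomSum_injective (le_refl 2) hii')

/-- **UNIFORM PIECES COMPOSE.** In the exact-support door, if every piece `p` of the design `e` is uniform — every
bijective enumeration `c` of its columns has, for EVERY injective row family `v` of the same size, a table making the block
`[∏_{a ∈ v x} (t none a + Σ_f ((e (c x')).2 f).elim 0 (t (some (f,·)) a))]` nonsingular — then for every injective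
`u : Fin r → Finset (Fin h)` some table `T` makes the whole `u`-side matrix of the design nonsingular. -/
theorem good_of_uniform_pieces (h m D N r : ℕ) (u : Fin r → Finset (Fin h))
    (e : Fin r → Fin m × (Fin D → Option (Fin N))) (hu : Function.Injective u) (he : Function.Injective e)
    (hU : ∀ (p : Fin m) (n : ℕ) (c : Fin n → Fin r), Function.Injective c → (∀ x, (e (c x)).1 = p) →
      (∀ k, (e k).1 = p → ∃ x, c x = k) → ∀ v : Fin n → Finset (Fin h), Function.Injective v →
        ∃ t : Option (Fin D × Fin N) → Fin h → ℂ,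
          (Matrix.of fun x x' : Fin n => ∏ a ∈ v x,
            (t none a + ∑ f : Fin D, ((e (c x')).2 f).elim 0 fun j => t (some (f, j)) a)).det ≠ 0) :
    ∃ T : Fin m → Option (Fin D × Fin N) → Fin h → ℂ,
      (Matrix.of fun i k : Fin r => ∏ a ∈ u i,
        (T (e k).1 none a + ∑ f : Fin D, ((e k).2 f).elim 0 fun j => T (e k).1 (some (f, j)) a)).det ≠ 0 := by
  induction r using Nat.strong_induction_on with
  | _ r ih =>
  rcases Nat.eq_zero_or_pos r with hr | hr
  · subst hr
    exact ⟨fun _ _ _ => 0, by rw [Matrix.det_isEmpty]; exact one_ne_zero⟩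
  -- the piece of column 0 and the column split
  set p₀ : Fin m := (e ⟨0, hr⟩).1 with hp₀
  set n : ℕ := Fintype.card {k : Fin r // (e k).1 = p₀} with hn
  set n' : ℕ := Fintype.card {k : Fin r // ¬ (e k).1 = p₀} with hn'
  have hnr : n ≤ r := by simpa using Fintype.card_subtype_le (fun k : Fin r => (e k).1 = p₀)
  have hn'r : n' = r - n := by simp [hn', hn, Fintype.card_subtype_compl]
  have hnpos : 0 < n := Fintype.card_pos_iff.mpr ⟨⟨⟨0, hr⟩, rfl⟩⟩
  have hnn' : n + n' = r := by omega
  have hlt : n' < r := by omega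
  let ec : Fin n ⊕ Fin n' ≃ Fin r :=
    (Equiv.sumCongr (Fintype.equivFin {k : Fin r // (e k).1 = p₀}).symm
      (Fintype.equivFin {k : Fin r // ¬ (e k).1 = p₀}).symm).trans (Equiv.sumCompl fun k : Fin r => (e k).1 = p₀)
  have hPl : ∀ x, (e (ec (Sum.inl x))).1 = p₀ := fun x => by
    simp only [ec, Equiv.trans_apply, Equiv.sumCongr_apply, Sum.map_inl, Equiv.sumCompl_apply_inl]
    exact ((Fintype.equivFin _).symm x).2
  have hPr : ∀ y, (e (ec (Sum.inr y))).1 ≠ p₀ := fun y => by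
    simp only [ec, Equiv.trans_apply, Equiv.sumCongr_apply, Sum.map_inr, Equiv.sumCompl_apply_inr]
    exact ((Fintype.equivFin _).symm y).2
  -- the row split: sort by binary weight, the `n` lightest rows first
  let wt : Fin r → ℕ := fun i => ∑ a ∈ u i, 2 ^ (a : ℕ)
  have hwt : Function.Injective wt := binaryWeight_injective u hu
  let σ : Equiv.Perm (Fin r) := Tuple.sort wt
  have hmono : Monotone (wt ∘ σ) := Tuple.monotone_sort wt
  let er : Fin n ⊕ Fin n' ≃ Fin r := (finSumFinEquiv.trans (finCongr hnn')).trans σ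
  have hthr : ∀ x y, ∑ a ∈ u (er (Sum.inl x)), 2 ^ (a : ℕ) < ∑ a ∈ u (er (Sum.inr y)), 2 ^ (a : ℕ) := by
    intro x y
    have hidx : (finCongr hnn' (finSumFinEquiv (Sum.inl x)) : Fin r) < finCongr hnn' (finSumFinEquiv (Sum.inr y)) := by
      rw [Fin.lt_def]
      simp only [finSumFinEquiv_apply_left, finSumFinEquiv_apply_right, finCongr_apply, Fin.val_cast,
        Fin.val_castAdd, Fin.val_natAdd]
      omega
    have hle : wt (σ (finCongr hnn' (finSumFinEquiv (Sum.inl x)))) ≤ wt (σ (finCongr hnn' (finSumFinEquiv (Sum.inr y)))) :=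
      hmono hidx.le
    have hne : wt (σ (finCongr hnn' (finSumFinEquiv (Sum.inl x)))) ≠ wt (σ (finCongr hnn' (finSumFinEquiv (Sum.inr y)))) := by
      intro heq
      exact (ne_of_lt hidx) (σ.injective (hwt heq))
    exact lt_of_le_of_ne hle hne
  -- block A: the piece `p₀` is uniform, hence good on the slice
  have hcinj : Function.Injective fun x : Fin n => ec (Sum.inl x) :=
    fun x x' hx => Sum.inl_injective (ec.injective hx)
  have hcsurj : ∀ k, (e k).1 = p₀ → ∃ x : Fin n, ec (Sum.inl x) = k := by
    intro k hk
    rcases hz : ec.symm k with x | y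
    · exact ⟨x, by rw [← hz, Equiv.apply_symm_apply]⟩
    · exact absurd (by rw [← Equiv.apply_symm_apply ec k, hz] at hk; exact hk) (hPr y)
  have hvinj : Function.Injective fun x : Fin n => u (er (Sum.inl x)) :=
    fun x x' hx => Sum.inl_injective (er.injective (hu hx))
  obtain ⟨t, ht⟩ := hU p₀ n (fun x => ec (Sum.inl x)) hcinj hPl hcsurj (fun x => u (er (Sum.inl x))) hvinj
  -- block B: the other pieces on the other rows, by induction
  have hu' : Function.Injective fun y : Fin n' => u (er (Sum.inr y)) :=
    fun y y' hy => Sum.inr_injective (er.injective (hu hy))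
  have he' : Function.Injective fun y : Fin n' => e (ec (Sum.inr y)) :=
    fun y y' hy => Sum.inr_injective (ec.injective (he hy))
  have hU' : ∀ (p : Fin m) (n'' : ℕ) (c : Fin n'' → Fin n'), Function.Injective c →
      (∀ x, (e (ec (Sum.inr (c x)))).1 = p) → (∀ y, (e (ec (Sum.inr y))).1 = p → ∃ x, c x = y) →
      ∀ v : Fin n'' → Finset (Fin h), Function.Injective v →
        ∃ t : Option (Fin D × Fin N) → Fin h → ℂ,
          (Matrix.of fun x x' : Fin n'' => ∏ a ∈ v x,
            (t none a + ∑ f : Fin D, ((e (ec (Sum.inr (c x')))).2 f).elim 0 fun j => t (some (f, j)) a)).det ≠ 0 := by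
    intro p n'' c hc hcp hcs v hv
    rcases Nat.eq_zero_or_pos n'' with h0 | h0
    · subst h0
      exact ⟨fun _ _ => 0, by rw [Matrix.det_isEmpty]; exact one_ne_zero⟩
    have hpp : p ≠ p₀ := by rw [← hcp ⟨0, h0⟩]; exact hPr _
    refine hU p n'' (fun x => ec (Sum.inr (c x))) (fun x x' hx => hc (Sum.inr_injective (ec.injective hx))) hcp ?_ v hv
    intro k hk
    rcases hz : ec.symm k with x | y
    · have hx : (e (ec (Sum.inl x))).1 = p := by rw [← Equiv.apply_symm_apply ec k, hz] at hk; exact hk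
      exact absurd (hx.symm.trans (hPl x)) hpp
    · have hy : (e (ec (Sum.inr y))).1 = p := by rw [← Equiv.apply_symm_apply ec k, hz] at hk; exact hk
      obtain ⟨x, hx⟩ := hcs y hy
      exact ⟨x, by rw [hx, ← hz, Equiv.apply_symm_apply]⟩
  obtain ⟨T', hT'⟩ := ih n' hlt (fun y => u (er (Sum.inr y))) (fun y => e (ec (Sum.inr y))) hu' he' hU'
  -- absorb
  exact good_of_absorb h m D N r u e p₀ (fun a => 2 ^ (a : ℕ)) er ec hPl hPr hthr (fun _ => t) T' ht hT'

open Literature.Barriers.ValiantsHypothesis in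
/-- **A design with uniform pieces serves EVERY layout of its size.** In the exact-support door with `m ≤ (2h)²` pieces,
`D ≤ 2h` factors and `N ≤ (2h)²` options (`h ≥ 3`): if every piece of the design `e` (an injective enumeration of the live
columns of `S`) is uniform, then for EVERY pair of injective families `u, w : Fin r → Finset (Fin h)` the partition minor on
`(u, w)` of some `F ∈ SmallCircuits ℂ (h+h) 10` is nonzero. (`good_of_uniform_pieces` on both sides +
`partitionMinor_hit_of_simplexJoin`; the size estimate is the one of `…SimplexJoinNodes.partitionMinor_hit_of_simplexJoin_mem_wide`.) -/
theorem partitionMinor_hit_of_uniformPieces (h m D N r : ℕ) (hh : 3 ≤ h) (hm : m ≤ (h + h) ^ 2)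
    (hD : D ≤ h + h) (hN : N ≤ (h + h) ^ 2) (u w : Fin r → Finset (Fin h))
    (hu : Function.Injective u) (hw : Function.Injective w)
    (S : Fin m → Fin D → Finset (Fin N))
    (e : Fin r → Fin m × (Fin D → Option (Fin N))) (he : Function.Injective e)
    (hlive : ∀ c : Fin m × (Fin D → Option (Fin N)),
      c ∈ Set.range e ↔ ∀ (f : Fin D) (j : Fin N), c.2 f = some j → j ∈ S c.1 f)
    (hU : ∀ (p : Fin m) (n : ℕ) (c : Fin n → Fin r), Function.Injective c → (∀ x, (e (c x)).1 = p) →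
      (∀ k, (e k).1 = p → ∃ x, c x = k) → ∀ v : Fin n → Finset (Fin h), Function.Injective v →
        ∃ t : Option (Fin D × Fin N) → Fin h → ℂ,
          (Matrix.of fun x x' : Fin n => ∏ a ∈ v x,
            (t none a + ∑ f : Fin D, ((e (c x')).2 f).elim 0 fun j => t (some (f, j)) a)).det ≠ 0) :
    ∃ F ∈ SmallCircuits ℂ (h + h) 10,
      (Matrix.of fun i j : Fin r => MvPolynomial.coeff
        (∑ a ∈ u i, Finsupp.single (Fin.castAdd h a) 1 +
          ∑ c ∈ w j, Finsupp.single (Fin.natAdd h c) 1) F).det ≠ 0 := by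
  obtain ⟨tx, hx⟩ := good_of_uniform_pieces h m D N r u e hu he hU
  obtain ⟨ty, hy⟩ := good_of_uniform_pieces h m D N r w e hw he hU
  obtain ⟨F, hdeg, hsize, hF⟩ := partitionMinor_hit_of_simplexJoin h m D N r u w S e he hlive tx ty hx hy
  refine ⟨F, ⟨hdeg, hsize.trans ?_⟩, hF⟩
  set H := h + h with hH
  have hH6 : 6 ≤ H := by omega
  have hHpos : 0 < H := by omega
  have hP : 3 * H + (D * (N * (3 * H) + N + 1) + D) + 1 ≤ 4 * H ^ 4 := by
    calc 3 * H + (D * (N * (3 * H) + N + 1) + D) + 1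
        ≤ 3 * H + (H * (H ^ 2 * (3 * H) + H ^ 2 + 1) + H) + 1 := by gcongr
      _ = 3 * H ^ 4 + H ^ 3 + 5 * H + 1 := by ring
      _ ≤ 3 * H ^ 4 + H ^ 4 := by nlinarith [pow_le_pow_left₀ (Nat.zero_le 6) hH6 2, pow_le_pow_left₀ (Nat.zero_le 6) hH6 3]
      _ = 4 * H ^ 4 := by ring
  have hsq : (H + 2) ^ 2 ≤ 2 * H ^ 2 := by nlinarith
  have h48 : H ^ 4 ≤ H ^ 8 := Nat.pow_le_pow_right hHpos (by norm_num)
  have h18 : H ≤ H ^ 8 := by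
    calc H = H ^ 1 := (pow_one H).symm
      _ ≤ H ^ 8 := Nat.pow_le_pow_right hHpos (by norm_num)
  have h08 : 1 ≤ H ^ 8 := Nat.one_le_pow _ _ hHpos
  have h12 : 12 ≤ H ^ 2 := by nlinarith
  calc (H + 2) ^ 2 * (m * (3 * H + (D * (N * (3 * H) + N + 1) + D) + 1) + m) + (H + 1)
      ≤ (2 * H ^ 2) * (H ^ 2 * (4 * H ^ 4) + H ^ 2) + (H + 1) := by gcongr
    _ = 8 * H ^ 8 + 2 * H ^ 4 + H + 1 := by ring
    _ ≤ 8 * H ^ 8 + 2 * H ^ 8 + H ^ 8 + H ^ 8 := by gcongr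
    _ = 12 * H ^ 8 := by ring
    _ ≤ H ^ 2 * H ^ 8 := Nat.mul_le_mul_right _ h12
    _ = H ^ 10 := by ring

end Summit.ValiantsHypothesis.ValiantsHypothesis.Theorems.BarrierLever.SimplexJoin
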